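import Summits.ResolutionOfSingularities.ResolutionOfSingularities.Theorems.FrobeniusLadderFInjectiveMacaulayficationPencilFedderRegularBasePole
import Summits.ResolutionOfSingularities.ResolutionOfSingularities.Theorems.FrobeniusLadderFInjectiveMacaulayficationPencilFedderTrinomial
import HarnessLib

/-!
# Fedder's test for the pencil `uX − v` read on an ARBITRARY coefficient, and the «code 3» recipe (middle binomial coefficient)
# (BED Ω₁ GLOBAL PATCH, F6 v2 §2, sequel of ✓ `PencilFedderRegularBase` / ✓ `PencilFedderRegularBasePole`;
# crux `FInjectiveMacaulayfication` stmt-ResolutionOfSingularities-15315, chain w45a; seat res-L1-w45a-stub-3 g15)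

[OURS · L1 W4.5a] Support file (`--supports stmt-ResolutionOfSingularities-15315 --as helper`); theorems only; GENERIC commutative algebra; no named fact; NOT a statement of any
manuscript; nothing of the crux is proved. AI-written (AI review is weaker than expert review).

* `coeff_linear_pow` — `((uX + c)^n).coeff d = (n choose d)·u^d·c^(n−d)`;
* ★ `pencil_pow_not_mem_frobeniusPower_pointIdeal_of_coeff` — if for some `d < p` the coefficient `(p−1 choose d)·u^d·(u w₀ − v)^(p−1−d)` of `(uX′ + (uw₀ − v))^(p−1)` (`X′ = X − w₀`)
  lies outside `I^[p]`, then `(uX − v)^(p−1) ∉ (I·B[X] + (X − w₀))^[p]` (the two-coefficient test of ✓ `PencilFedderRegularBase` is `d ∈ {0, p−1}`);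
* `isUnit_natCast_of_not_dvd`, `not_dvd_choose_sub_one`, `isUnit_choose_sub_one` — `(p−1 choose d)` is a unit in characteristic `p` for `d ≤ p − 1`;
* ★★ `middle_coeff_not_mem_frobeniusPower` («code 3»): `(R, 𝔪)` regular local of odd characteristic `p`, `s` an r.s.o.p., `u = ε·∏ s[i]^(a i)`, `v = ε′·∏ s[i]^(m i)` with units `ε, ε′`,
  `a i + m i ≤ 2` for all `i` and a letter `i₁` with `a i₁ ≠ 0 = m i₁` ⇒ for EVERY `w₀` the middle coefficient (`d = (p−1)/2`) lies outside `𝔪^[p]`;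
* ★★ `fullCl_localization_pencilQuot_of_coeff` — `B` regular local of characteristic `p` with algebraically closed residue field, `u, v ∈ 𝔪`, `B[X]/(uX − v)` a domain and, at every `w₀`,
  SOME coefficient outside `𝔪^[p]` ⇒ `(B[X]/(uX − v))_Q` is `FullCl p` at every prime `Q` over `𝔪`; `fullCl_localization_pencilQuot_code3` — the code-3 instance (both charts by symmetry).
[cite: Fedder1983, Prop. 1.7, Thm. 1.12; HunekeSwanson2006, proof of Thm. 13.1.2 (6)]
-/

set_option linter.dupNamespace false

noncomputable section

namespace Summit.ResolutionOfSingularities.ResolutionOfSingularities.Theorems.FInjectiveMacaulayfication.PencilFedderCoeff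

open IsLocalRing Polynomial Literature.RingTheory.TightClosure Literature.AlgebraicGeometry.Resolution
open Summit.ResolutionOfSingularities.ResolutionOfSingularities.Theorems.FInjectiveMacaulayfication SliceableCentre PencilFedderRegularBase
  PencilFedderRegularBasePole SopFrobeniusPower PencilFedderTrinomial

universe u

variable (p : ℕ) [Fact p.Prime]

/-! ## §1 The general coefficient of `(uX + c)^n` -/

section Poly

variable {B : Type} [CommRing B]

omit [Fact p.Prime] in
/-- `((uX + c)^n).coeff d = (n choose d)·u^d·c^(n−d)`. [folklore] -/
theorem coeff_linear_pow (u c : B) (n d : ℕ) : ((C u * X + C c) ^ n).coeff d = (n.choose d : B) * u ^ d * c ^ (n - d) := by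
  rw [add_pow, finsetSum_coeff]
  simp only [mul_pow, ← C_pow, ← C_eq_natCast, coeff_mul_C, coeff_C_mul_X_pow]
  rw [Finset.sum_eq_single d]
  · rw [if_pos rfl]; ring
  · intro m _ hm
    rw [if_neg (Ne.symm hm), zero_mul, zero_mul]
  · intro hd
    have hlt : n < d := by rw [Finset.mem_range] at hd; omega
    rw [Nat.choose_eq_zero_of_lt hlt, Nat.cast_zero, mul_zero]

/-- ★ **Fedder's test for the pencil at a point of the fibre line, read on the coefficient of `X′^d`** (`X′ = X − w₀`, `d < p`): if `(p−1 choose d)·u^d·(u w₀ − v)^(p−1−d) ∉ I^[p]`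
then `(uX − v)^(p−1) ∉ (I·B[X] + (X − w₀))^[p]`. [cite: Fedder1983, Prop. 1.7] -/
theorem pencil_pow_not_mem_frobeniusPower_pointIdeal_of_coeff [CharP B p] (I : Ideal B) (u v w₀ : B) (d : ℕ) (hd : d < p)
    (h : ((p - 1).choose d : B) * u ^ d * (u * w₀ - v) ^ (p - 1 - d) ∉ frobeniusPower p I) :
    (C u * X - C v) ^ (p - 1) ∉ frobeniusPower p (I.map (C : B →+* B[X]) ⊔ Ideal.span {X - C w₀}) := by
  intro hmem
  rw [frobeniusPower_pointIdeal] at hmem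
  set σ : B[X] →+* B[X] := ((algEquivAevalXAddC w₀ : B[X] ≃ₐ[B] B[X]) : B[X] →+* B[X]) with hσ
  have hmem' : σ ((C u * X - C v) ^ (p - 1)) ∈ ((frobeniusPower p I).map (C : B →+* B[X]) ⊔ Ideal.span {(X - C w₀) ^ p}).map σ :=
    Ideal.mem_map_of_mem σ hmem
  rw [hσ, map_shift_pointIdeal_pow, map_pow, shift_pencil] at hmem'
  apply h
  have := coeff_mem_of_mem_map_C_sup (frobeniusPower p I) p _ hmem' d hd
  rwa [coeff_linear_pow] at this

end Poly

section Units

variable {A : Type u} [CommRing A]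

/-- `(n : A)` is a unit in characteristic `p` when `p ∤ n`. [folklore] -/
theorem isUnit_natCast_of_not_dvd [CharP A p] (n : ℕ) (hn : ¬ p ∣ n) : IsUnit (n : A) := by
  have h : IsUnit ((n : ZMod p)) := by
    rw [isUnit_iff_ne_zero, Ne, CharP.cast_eq_zero_iff (ZMod p) p n]
    exact hn
  have := h.map (ZMod.castHom (dvd_refl p) A)
  rwa [map_natCast] at this

/-- `p ∤ (p−1 choose d)` for `d ≤ p − 1`. [folklore] -/
theorem not_dvd_choose_sub_one (d : ℕ) (hd : d ≤ p - 1) : ¬ p ∣ (p - 1).choose d := by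
  intro h
  have hfac : p ∣ (p - 1).factorial := by
    rw [← Nat.choose_mul_factorial_mul_factorial hd, mul_assoc]
    exact dvd_mul_of_dvd_left h _
  have := ((Fact.out : p.Prime).dvd_factorial).mp hfac
  have := (Fact.out : p.Prime).two_le
  omega

/-- `(p−1 choose d : A)` is a unit in characteristic `p` (`d ≤ p − 1`). [folklore] -/
theorem isUnit_choose_sub_one [CharP A p] (d : ℕ) (hd : d ≤ p - 1) : IsUnit (((p - 1).choose d : ℕ) : A) :=
  isUnit_natCast_of_not_dvd p _ (not_dvd_choose_sub_one p d hd)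

end Units

/-! ## §2 «Code 3»: the middle coefficient -/

section Code3

variable {R : Type u} [CommRing R] [IsRegularLocalRing R] [CharP R p]

/-- ★★ **CODE 3 (middle binomial coefficient).** `p` odd, `s` an r.s.o.p. of the regular local ring `(R, 𝔪)`, `u = ε·∏ s[i]^(a i)`, `v = ε′·∏ s[i]^(m i)` with `ε, ε′` units,
`a i + m i ≤ 2` for every `i`, and a letter `i₁` with `a i₁ ≠ 0`, `m i₁ = 0`. Then for EVERY `w₀ ∈ R` the coefficient of `X′^d`, `d = (p−1)/2`, of `(uX′ + (uw₀ − v))^(p−1)`, namely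
`(p−1 choose d)·u^d·(uw₀ − v)^d = ±(p−1 choose d)(εε′)^d·∏ s[i]^(d(a i + m i)) + u^(d+1)·w₀·H`, lies outside `𝔪^[p]`: the first monomial has exponents `≤ p − 1`
(✓ `SopFrobeniusPower.unit_mul_monomial_add_not_mem_frobeniusPower`), the rest overflows at the letter `i₁`. [OURS · F6 v2 §2 code 3; cite: Fedder1983, Prop. 1.7] -/
theorem middle_coeff_not_mem_frobeniusPower (hp : p ≠ 2) (s : List R) (hspan : Ideal.ofList s = maximalIdeal R) (hlen : (s.length : WithBot ℕ∞) = ringKrullDim R)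
    (a m : ℕ → ℕ) (ham : ∀ i, a i + m i ≤ 2) (i₁ : Fin s.length) (ha₁ : a i₁ ≠ 0) (hm₁ : m i₁ = 0)
    (ε ε' : R) (hε : IsUnit ε) (hε' : IsUnit ε') (u v : R)
    (hu : u = ε * ∏ i : Fin s.length, s[i] ^ a i) (hv : v = ε' * ∏ i : Fin s.length, s[i] ^ m i) (w₀ : R) :
    (((p - 1).choose ((p - 1) / 2) : ℕ) : R) * u ^ ((p - 1) / 2) * (u * w₀ - v) ^ (p - 1 - (p - 1) / 2) ∉ frobeniusPower p (maximalIdeal R) := by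
  have hodd : p % 2 = 1 := (Fact.out : p.Prime).eq_two_or_odd.resolve_left hp
  set d := (p - 1) / 2 with hd
  have h2d : p - 1 = 2 * d := by omega
  have hdd : p - 1 - d = d := by omega
  rw [hdd]
  -- `(uw₀ − v)^d = (−v)^d + u w₀ H`
  obtain ⟨H, hH⟩ : u * w₀ ∣ (u * w₀ - v) ^ d - (-v) ^ d := by
    have := sub_dvd_pow_sub_pow (u * w₀ - v) (-v) d
    rwa [show u * w₀ - v - -v = u * w₀ by ring] at this
  have hx : (u * w₀ - v) ^ d = (-v) ^ d + u * w₀ * H := by rw [← hH]; ring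
  rw [hx]
  subst hu hv
  have key : (((p - 1).choose d : ℕ) : R) * (ε * ∏ i : Fin s.length, s[i] ^ a i) ^ d *
        ((-(ε' * ∏ i : Fin s.length, s[i] ^ m i)) ^ d + ε * (∏ i : Fin s.length, s[i] ^ a i) * w₀ * H) =
      ((((p - 1).choose d : ℕ) : R) * (-1) ^ d * ε ^ d * ε' ^ d) * ((∏ i : Fin s.length, s[i] ^ a i) ^ d * (∏ i : Fin s.length, s[i] ^ m i) ^ d) +
        ((((p - 1).choose d : ℕ) : R) * w₀ * H * ε ^ (d + 1)) * (∏ i : Fin s.length, s[i] ^ a i) ^ (d + 1) := by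
    ring
  have hA : (∏ i : Fin s.length, s[i] ^ a i) ^ d * (∏ i : Fin s.length, s[i] ^ m i) ^ d = ∏ i : Fin s.length, s[i] ^ (d * a i + d * m i) := by
    rw [prod_pow_pow, prod_pow_pow]
    exact prod_pow_mul_prod_pow s (fun i => d * a i) (fun i => d * m i)
  have hB : (∏ i : Fin s.length, s[i] ^ a i) ^ (d + 1) * (∏ i : Fin s.length, s[i] ^ (p - 1 - (d * a i + d * m i))) =
      ∏ i : Fin s.length, s[i] ^ ((d + 1) * a i + (p - 1 - (d * a i + d * m i))) := by
    rw [prod_pow_pow]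
    exact prod_pow_mul_prod_pow s (fun i => (d + 1) * a i) (fun i => p - 1 - (d * a i + d * m i))
  rw [key, hA]
  have hU : IsUnit ((((p - 1).choose d : ℕ) : R) * (-1) ^ d * ε ^ d * ε' ^ d) :=
    (((isUnit_choose_sub_one p d (by omega)).mul ((isUnit_one.neg).pow _)).mul (hε.pow _)).mul (hε'.pow _)
  have he : ∀ i, d * a i + d * m i ≤ p - 1 := by
    intro i
    have := Nat.mul_le_mul_left d (ham i)
    rw [mul_add] at this
    omega
  refine unit_mul_monomial_add_not_mem_frobeniusPower p s hspan hlen (fun i => d * a i + d * m i) he _ hU _ ?_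
  show _ * (∏ i : Fin s.length, s[i] ^ (p - 1 - (d * a i + d * m i))) ∈ _
  rw [mul_assoc, hB]
  refine mul_monomial_mem_frobeniusPower_of_le p s hspan (fun i => (d + 1) * a i + (p - 1 - (d * a i + d * m i))) i₁ ?_ _
  have h1 := he i₁
  simp only [hm₁, mul_zero, add_zero] at h1 ⊢
  rw [add_one_mul]
  have : 1 ≤ a i₁ := Nat.one_le_iff_ne_zero.mpr ha₁
  omega

end Code3

/-! ## §3 FULL of the pencil quotient from the test on an arbitrary coefficient -/

section Regular

variable {B : Type} [CommRing B] [IsRegularLocalRing B] [CharP B p]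

omit [IsRegularLocalRing B] [CharP B p] in
/-- The pencil is nonzero as soon as some coefficient `(p−1 choose d)·u^d·(uw₀ − v)^(p−1−d)` (`d < p`) lies outside `𝔪^[p]`. [plumbing] -/
theorem pencil_ne_zero_of_coeff [IsLocalRing B] (u v w₀ : B) (d : ℕ) (hd : d < p)
    (h : ((p - 1).choose d : B) * u ^ d * (u * w₀ - v) ^ (p - 1 - d) ∉ frobeniusPower p (maximalIdeal B)) :
    (C u * X - C v : B[X]) ≠ 0 := by
  intro h0
  have hu : u = 0 := by
    have := congrArg (fun g : B[X] => g.coeff 1) h0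
    simpa using this
  have hv : v = 0 := by
    have := congrArg (fun g : B[X] => g.coeff 0) h0
    simpa using this
  apply h
  rw [hu, hv, zero_mul, sub_zero]
  rcases Nat.eq_zero_or_pos d with hd0 | hd0
  · have hp1 : p - 1 - d ≠ 0 := by have := (Fact.out : p.Prime).two_le; omega
    rw [zero_pow hp1, mul_zero]
    exact Ideal.zero_mem _
  · rw [zero_pow hd0.ne', mul_zero, zero_mul]
    exact Ideal.zero_mem _

/-- ★ **FULL AT A POINT OF THE FIBRE LINE from the test on the coefficient of `X′^d`** (`d < p`). [OURS · F6 v2 §2; cite: Fedder1983, Prop. 1.7, Thm. 1.12] -/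
theorem fullCl_localization_pencilQuot_pointIdeal_of_coeff (u v w₀ : B) (hu : u ∈ maximalIdeal B) (hv : v ∈ maximalIdeal B) (d : ℕ) (hd : d < p)
    (hfed : ((p - 1).choose d : B) * u ^ d * (u * w₀ - v) ^ (p - 1 - d) ∉ frobeniusPower p (maximalIdeal B))
    (hdom : IsDomain (B[X] ⧸ Ideal.span {C u * X - C v}))
    (Q : Ideal (B[X] ⧸ Ideal.span {C u * X - C v})) [Q.IsPrime]
    (hQ : Q.comap (Ideal.Quotient.mk (Ideal.span {C u * X - C v})) = (maximalIdeal B).map (C : B →+* B[X]) ⊔ Ideal.span {X - C w₀}) :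
    FullCl p (Localization.AtPrime Q) := by
  haveI hQ'max : ((maximalIdeal B).map (C : B →+* B[X]) ⊔ Ideal.span {X - C w₀}).IsMaximal := isMaximal_pointIdeal w₀
  exact fullCl_localization_quot_of_fedder p (C u * X - C v) _ (comap_C_pointIdeal w₀) (pencil_mem_pointIdeal u v w₀ hu hv)
    (pencil_ne_zero_of_coeff p u v w₀ d hd hfed) (pencil_pow_not_mem_frobeniusPower_pointIdeal_of_coeff p (maximalIdeal B) u v w₀ d hd hfed) hdom Q hQ

/-- ★★ **FULL AT EVERY PRIME OVER `𝔪` from the test on SOME coefficient at every `w₀`** (residue field algebraically closed; `u, v ∈ 𝔪`; `B[X]/(uX − v)` a domain).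
[OURS · F6 v2 §2; cite: Fedder1983, Thm. 1.12; StacksProject, Tag 02C5] -/
theorem fullCl_localization_pencilQuot_of_coeff [IsAlgClosed (ResidueField B)] (u v : B) (hu : u ∈ maximalIdeal B) (hv : v ∈ maximalIdeal B)
    (hfed : ∀ w₀ : B, ∃ d : ℕ, d < p ∧ ((p - 1).choose d : B) * u ^ d * (u * w₀ - v) ^ (p - 1 - d) ∉ frobeniusPower p (maximalIdeal B))
    (hdom : IsDomain (B[X] ⧸ Ideal.span {C u * X - C v}))
    (Q : Ideal (B[X] ⧸ Ideal.span {C u * X - C v})) [Q.IsPrime]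
    (hQ : (Q.comap (Ideal.Quotient.mk (Ideal.span {C u * X - C v}))).comap (C : B →+* B[X]) = maximalIdeal B) :
    FullCl p (Localization.AtPrime Q) := by
  haveI : IsDomain B := isDomain_of_isRegularLocalRing B
  haveI : (Q.comap (Ideal.Quotient.mk (Ideal.span {C u * X - C v}))).IsPrime := Ideal.comap_isPrime _ Q
  rcases eq_map_C_or_exists_point (Q.comap (Ideal.Quotient.mk (Ideal.span {C u * X - C v}))) hQ with hgen | ⟨w₀, hw₀⟩
  · -- the generic point of the fibre line: localize the point `w₀ = 0`
    have hfQ₀' : C u * X - C v ∈ (maximalIdeal B).map (C : B →+* B[X]) ⊔ Ideal.span {X - C 0} := pencil_mem_pointIdeal u v 0 hu hv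
    have hker : RingHom.ker (Ideal.Quotient.mk (Ideal.span {C u * X - C v})) ≤ (maximalIdeal B).map (C : B →+* B[X]) ⊔ Ideal.span {X - C 0} := by
      rw [Ideal.mk_ker]; exact (Ideal.span_singleton_le_iff_mem _).mpr hfQ₀'
    haveI hQ₀'max : ((maximalIdeal B).map (C : B →+* B[X]) ⊔ Ideal.span {X - C 0}).IsMaximal := isMaximal_pointIdeal 0
    haveI hQ₀p : (((maximalIdeal B).map (C : B →+* B[X]) ⊔ Ideal.span {X - C 0}).map (Ideal.Quotient.mk (Ideal.span {C u * X - C v}))).IsPrime :=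
      Ideal.map_isPrime_of_surjective Ideal.Quotient.mk_surjective hker
    have hQ₀c : (((maximalIdeal B).map (C : B →+* B[X]) ⊔ Ideal.span {X - C 0}).map (Ideal.Quotient.mk (Ideal.span {C u * X - C v}))).comap
        (Ideal.Quotient.mk (Ideal.span {C u * X - C v})) = (maximalIdeal B).map (C : B →+* B[X]) ⊔ Ideal.span {X - C 0} := by
      rw [Ideal.comap_map_of_surjective _ Ideal.Quotient.mk_surjective, sup_eq_left]
      exact le_trans (fun z hz => hz) hker
    obtain ⟨d₀, hd₀, hfed₀⟩ := hfed 0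
    have hfull₀ := fullCl_localization_pencilQuot_pointIdeal_of_coeff p u v 0 hu hv d₀ hd₀ hfed₀ hdom _ hQ₀c
    obtain ⟨Q₀, hQ₀p', hQ₀def⟩ : ∃ Q₀ : Ideal (B[X] ⧸ Ideal.span {C u * X - C v}), Q₀.IsPrime ∧
        Q₀ = ((maximalIdeal B).map (C : B →+* B[X]) ⊔ Ideal.span {X - C 0}).map (Ideal.Quotient.mk (Ideal.span {C u * X - C v})) := ⟨_, hQ₀p, rfl⟩
    haveI := hQ₀p'
    have hfull₀' : FullCl p (Localization.AtPrime Q₀) := by subst hQ₀def; exact hfull₀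
    have hle : Q ≤ Q₀ := by
      have h1 : Q = (Q.comap (Ideal.Quotient.mk (Ideal.span {C u * X - C v}))).map (Ideal.Quotient.mk (Ideal.span {C u * X - C v})) :=
        (Ideal.map_comap_of_surjective _ Ideal.Quotient.mk_surjective Q).symm
      rw [h1, hgen, hQ₀def]
      exact Ideal.map_mono le_sup_left
    haveI : CharP (B[X] ⧸ Ideal.span {C u * X - C v}) p :=
      CharP.of_ringHom_of_ne_zero (Ideal.Quotient.mk (Ideal.span {C u * X - C v})) p (Fact.out : p.Prime).ne_zero
    exact fullCl_localization_of_le p Q Q₀ hle hfull₀'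
  · obtain ⟨d, hd, hfed'⟩ := hfed w₀
    exact fullCl_localization_pencilQuot_pointIdeal_of_coeff p u v w₀ hu hv d hd hfed' hdom Q hw₀

/-- ★★ **CODE 3 ⇒ FULL at every prime over `𝔪` of the chart `B[X]/(uX − v)`** (`p` odd; residue field algebraically closed; `u = ε·∏ s[i]^(a i)`, `v = ε′·∏ s[i]^(m i)` on an r.s.o.p. `s`,
`a i + m i ≤ 2`, a letter `i₁` with `a i₁ ≠ 0 = m i₁`, `v ∈ 𝔪`, `B[X]/(uX − v)` a domain). For the other chart `B[X′]/(vX′ − u)` apply the same theorem with `(u, v, a, m)` swapped and a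
letter `i₂` with `m i₂ ≠ 0 = a i₂`. [OURS · F6 v2 §2 code 3; cite: Fedder1983, Thm. 1.12] -/
theorem fullCl_localization_pencilQuot_code3 [IsAlgClosed (ResidueField B)] (hp : p ≠ 2)
    (s : List B) (hspan : Ideal.ofList s = maximalIdeal B) (hlen : (s.length : WithBot ℕ∞) = ringKrullDim B)
    (a m : ℕ → ℕ) (ham : ∀ i, a i + m i ≤ 2) (i₁ : Fin s.length) (ha₁ : a i₁ ≠ 0) (hm₁ : m i₁ = 0)
    (ε ε' : B) (hε : IsUnit ε) (hε' : IsUnit ε') (u v : B)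
    (hu : u = ε * ∏ i : Fin s.length, s[i] ^ a i) (hv : v = ε' * ∏ i : Fin s.length, s[i] ^ m i) (hvm : v ∈ maximalIdeal B)
    (hdom : IsDomain (B[X] ⧸ Ideal.span {C u * X - C v}))
    (Q : Ideal (B[X] ⧸ Ideal.span {C u * X - C v})) [Q.IsPrime]
    (hQ : (Q.comap (Ideal.Quotient.mk (Ideal.span {C u * X - C v}))).comap (C : B →+* B[X]) = maximalIdeal B) :
    FullCl p (Localization.AtPrime Q) := by
  have hum : u ∈ maximalIdeal B := by
    rw [hu, ← hspan]
    refine Ideal.mul_mem_left _ _ ?_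
    have hs₁ : s[i₁] ∈ Ideal.ofList s := Ideal.subset_span (List.getElem_mem i₁.2)
    have hsi : s[i₁] ^ a i₁ ∈ Ideal.ofList s := Ideal.pow_mem_of_mem (Ideal.ofList s) hs₁ _ (Nat.pos_of_ne_zero ha₁)
    have := Ideal.mul_mem_left (Ideal.ofList s) (∏ i ∈ Finset.univ.erase i₁, s[i] ^ a i) hsi
    rwa [Finset.prod_erase_mul _ _ (Finset.mem_univ i₁)] at this
  have hodd : p % 2 = 1 := (Fact.out : p.Prime).eq_two_or_odd.resolve_left hp
  refine fullCl_localization_pencilQuot_of_coeff p u v hum hvm (fun w₀ => ⟨(p - 1) / 2, by omega, ?_⟩) hdom Q hQ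
  exact middle_coeff_not_mem_frobeniusPower p hp s hspan hlen a m ham i₁ ha₁ hm₁ ε ε' hε hε' u v hu hv w₀

end Regular

end Summit.ResolutionOfSingularities.ResolutionOfSingularities.Theorems.FInjectiveMacaulayfication.PencilFedderCoeff

end
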